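import Literature.NumberTheory.LocalFields.RamifiedPlaceFixedValuationParity     -- ★ CM rows: fixed ⇒ even order, anti-fixed ⇒ odd order (with an anti-fixed uniformiser)
import HarnessLib

/-!
# R90 · S1 ∕ U4Keys leaf (U4f-χ₁-ram-one-d0B) — THE `e = 2` SHELL GEOMETRY OF THE HEISENBERG CHART `z = a + y` (`a` FIXED, `y` ANTI-FIXED) AT A TAME RAMIFIED PLACE:
# `|a + y|_w = max(|a|_w, |y|_w)`, `|y|_w ≠ 1`, `|a + y|_w = 1 ⟺ |a|_w = 1 ∧ |y|_w < 1`, `|a + y|_w = q_w ⟺ |y|_w = q_w ∧ |a|_w ≤ 1`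
# [SerreLocalFields1979 Ch. III §6, Ch. IV §2 Prop. 5; Rogawski1990 §1.10; PAPER-Z3-DepthZeroRamified §1 (R90-C10-p05 (g0), r01-screened)]

Cell `hodgecm-mathlib`, SLAB R90-TF, section S1 «Ch. 12 local», crux H413 = `stmt-HodgeConjecture-24833` (lane `--supports … --as helper`), route HCCMUnconditional; prover seat
`hodgecm-mathlib-R90-C10-p05` (g0); socket of record S1#3′ = K2E3 leaf (U4f-χ₁-ram-one) ⊇ U4Keys :155 (depth 0, Branch B).  THEOREMS ONLY (no definition ∕ instance ∕ notation ∕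
named fact ∕ `sorry`); ★-only imports.

THE POINT.  The three RAMIFIED SHELL IDENTITIES left open by ★∕📤 `R90S1KeysThmTwoDepthZeroBranchBRamified` (`hscal`, `h1`, `h0` of `exists_eta_of_reducible_of_shellIdentities_ram`) are
computed, as in the inert ★ `K2E3BranchBShellZeroFibres`, in the Heisenberg chart `z = heisZ σ x y = a + y` with `a = −½xσx` `σ_w`-FIXED and `y ∈ R⁻` `σ_w`-ANTI-FIXED.  At an INERT place the
fibre trichotomy rests on `|a|_w = |x|_w²` and the inert skew-line integrals; at a TAME RAMIFIED place (`e(w|v) = 2`, `|2|_w = 1`) the geometry is simpler and different: fixed elements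
have EVEN order and anti-fixed elements ODD order (★ `RamifiedPlaceFixedValuationParity`, with the anti-fixed uniformiser of ★ `exists_uniformizer_galAdicCompletionMap_complexConj_eq_neg_of_ramified`),
so `|a|_w ≠ |y|_w` and the ultrametric inequality is an equality.  This file records exactly the shell-membership statements the ramified (II)-a ∕ (II)-b fibre computations need:
* `valued_ne_of_fixed_of_skew_ram` — `a ≠ 0` fixed, `y` anti-fixed ⟹ `|a|_w ≠ |y|_w`;
* `valued_fixed_add_skew_eq_max_ram` — `|a + y|_w = max(|a|_w, |y|_w)`;
* `valued_skew_ne_one_ram` — `|y|_w ≠ 1` (no anti-fixed unit); `valued_fixed_ne_exp_one_ram` — `|a|_w ≠ q_w` (no fixed element of order one);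
* `valued_fixed_add_skew_eq_one_iff_ram` — SHELL ZERO: `|a + y|_w = 1 ⟺ |a|_w = 1 ∧ |y|_w < 1` (so on `Sh 0` the chart point is `a·(1 + y∕a)`, a fixed unit times a principal unit);
* `valued_fixed_add_skew_eq_exp_one_iff_ram` — SHELL ONE: `|a + y|_w = q_w ⟺ |y|_w = q_w ∧ |a|_w ≤ 1` (so on `Sh 1` the chart point is `y·(1 + a∕y)`, an anti-fixed element of order
  one times a principal unit — whence `∫_{Sh 1} F₀ = 0` by the character sum over `𝒪_F^× ↠ 𝔽_q^×`).
HONEST LABEL.  HC_CM is proved only modulo the 7 printed citations (2 remaining named inputs: hLiu418 = `stmt-HodgeConjecture-24832`, h413 = `stmt-HodgeConjecture-24833`) until rung 0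
closes; count-neutral — this file does NOT pay the leaf; no printed citation is discharged.

## References
* [SerreLocalFields1979] J.-P. Serre, *Local Fields*, GTM 67 (1979), Ch. III §6 (totally ramified extensions), Ch. IV §2 Prop. 5.
* [Rogawski1990] J. D. Rogawski, *Automorphic Representations of Unitary Groups in Three Variables*, Ann. of Math. Stud. 123 (1990), §1.10 p. 9 (`u(x, z)`), §12.2 (2) p. 173.
* [Keys1984] D. Keys, *Principal series representations of special unitary groups over local fields*, Compositio Math. 51 (1984), §7 Theorem (2) (d) p. 126.
-/

set_option autoImplicit false
-- the mandated namespace has the single-problem summit's repeated segment (`HodgeConjecture.HodgeConjecture`)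
set_option linter.dupNamespace false

noncomputable section

open NumberField IsDedekindDomain
open scoped Valued
open Literature.NumberTheory Literature.NumberTheory.Automorphic Literature.NumberTheory.Automorphic.UnitaryGroup
open Literature.NumberTheory.LocalFields.RamifiedPlaceFixedValuationParity

namespace Summit.HodgeConjecture.HodgeConjecture.R90.S1

variable (L : Type) [Field L] [NumberField L] [IsCMField L] {v : HeightOneSpectrum (𝓞 ↥(maximalRealSubfield L))}
  (w : PlacesOver L v) (hw : IsCMField.complexConj L • w.1 = w.1)

/-! ## §1 Fixed and anti-fixed elements never share a valuation -/

/-- **`|a|_w ≠ |y|_w`** for `a ≠ 0` fixed and `y` anti-fixed under `σ_w`, at a TAME RAMIFIED non-split CM place (`e(w|v) = 2`, `|2|_w = 1`): `log |a|_w` is even (★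
`even_log_valued_of_complexConj_eq_self`) and, `y ≠ 0`, `log |y|_w` is odd (★ `odd_log_valued_of_complexConj_eq_neg_of_uniformizer` with the anti-fixed uniformiser of ★
`exists_uniformizer_galAdicCompletionMap_complexConj_eq_neg_of_ramified`); `y = 0` has `|y|_w = 0 ≠ |a|_w`. [cite: SerreLocalFields1979, Ch. III §6, Ch. IV §2 Prop. 5] -/
theorem valued_ne_of_fixed_of_skew_ram (he : v.asIdeal.ramificationIdx' w.1.asIdeal ≠ 1) (h2w : Valued.v (2 : w.1.adicCompletion L) = 1)
    {a y : w.1.adicCompletion L} (ha0 : a ≠ 0) (hσa : galAdicCompletionMap (L := L) (IsCMField.complexConj L) hw a = a)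
    (hσy : galAdicCompletionMap (L := L) (IsCMField.complexConj L) hw y = -y) : Valued.v a ≠ Valued.v y := by
  intro h
  by_cases hy0 : y = 0
  · rw [hy0, map_zero] at h
    exact ha0 ((Valuation.zero_iff _).1 h)
  obtain ⟨θ, hθ, hσθ⟩ := exists_uniformizer_galAdicCompletionMap_complexConj_eq_neg_of_ramified L w hw he h2w
  obtain ⟨k, hk⟩ := even_log_valued_of_complexConj_eq_self L w hw he ha0 hσa
  obtain ⟨m, hm⟩ := odd_log_valued_of_complexConj_eq_neg_of_uniformizer L w hw he hθ hσθ hy0 hσy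
  rw [h] at hk
  omega

/-- **`|a + y|_w = max(|a|_w, |y|_w)`** for `a` fixed and `y` anti-fixed at a tame ramified non-split CM place — the ultrametric inequality is an equality because the two
valuations differ (§1; `a = 0` is trivial).  The `e = 2` replacement of the inert `|−½xσx + y|_w` trichotomy of ★ `K2E3BranchBShellZeroFibres`. [cite: SerreLocalFields1979, Ch. III §6]
[cite: Rogawski1990, §1.10 p. 9] -/
theorem valued_fixed_add_skew_eq_max_ram (he : v.asIdeal.ramificationIdx' w.1.asIdeal ≠ 1) (h2w : Valued.v (2 : w.1.adicCompletion L) = 1)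
    {a y : w.1.adicCompletion L} (hσa : galAdicCompletionMap (L := L) (IsCMField.complexConj L) hw a = a)
    (hσy : galAdicCompletionMap (L := L) (IsCMField.complexConj L) hw y = -y) :
    Valued.v (a + y) = max (Valued.v a) (Valued.v y) := by
  by_cases ha0 : a = 0
  · rw [ha0, zero_add, map_zero, max_eq_right zero_le]
  exact Valuation.map_add_of_distinct_val _ (valued_ne_of_fixed_of_skew_ram L w hw he h2w ha0 hσa hσy)

/-- **No anti-fixed unit: `|y|_w ≠ 1`** for `y` anti-fixed at a tame ramified non-split CM place (odd order, or `y = 0`). [cite: SerreLocalFields1979, Ch. IV §2 Prop. 5] -/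
theorem valued_skew_ne_one_ram (he : v.asIdeal.ramificationIdx' w.1.asIdeal ≠ 1) (h2w : Valued.v (2 : w.1.adicCompletion L) = 1)
    {y : w.1.adicCompletion L} (hσy : galAdicCompletionMap (L := L) (IsCMField.complexConj L) hw y = -y) : Valued.v y ≠ 1 := by
  have h := valued_ne_of_fixed_of_skew_ram L w hw he h2w (a := 1) one_ne_zero (map_one _) hσy
  rwa [map_one, ne_comm] at h

/-- **No fixed element of order one: `|a|_w ≠ q_w`** (`= exp 1`) for `a` fixed at a ramified non-split CM place (even order, or `a = 0`). [cite: SerreLocalFields1979, Ch. III §6] -/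
theorem valued_fixed_ne_exp_one_ram (he : v.asIdeal.ramificationIdx' w.1.asIdeal ≠ 1)
    {a : w.1.adicCompletion L} (hσa : galAdicCompletionMap (L := L) (IsCMField.complexConj L) hw a = a) : Valued.v a ≠ WithZero.exp (1 : ℤ) := by
  intro h
  by_cases ha0 : a = 0
  · rw [ha0, map_zero] at h
    exact WithZero.zero_ne_coe h
  obtain ⟨k, hk⟩ := even_log_valued_of_complexConj_eq_self L w hw he ha0 hσa
  rw [h, WithZero.log_exp] at hk
  omega

/-! ## §2 Shell zero and shell one in the chart `z = a + y` -/

/-- **SHELL ZERO: `|a + y|_w = 1 ⟺ |a|_w = 1 ∧ |y|_w < 1`** (`a` fixed, `y` anti-fixed, tame ramified non-split CM place): by §1 `|a + y|_w = max(|a|_w, |y|_w)` and `|y|_w ≠ 1`.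
Hence on `Sh 0` the chart point is `a·(1 + y∕a)` with `a` a fixed unit and `1 + y∕a` a principal unit — the input of the ramified shell-zero value `∫_{Sh 0} F₀ = χ₁(−2)·((q−1)∕q)·V`.
[cite: SerreLocalFields1979, Ch. IV §2 Prop. 5] [cite: Rogawski1990, §1.10 p. 9] [cite: Keys1984, §7 Theorem (2) (d) p. 126] -/
theorem valued_fixed_add_skew_eq_one_iff_ram (he : v.asIdeal.ramificationIdx' w.1.asIdeal ≠ 1) (h2w : Valued.v (2 : w.1.adicCompletion L) = 1)
    {a y : w.1.adicCompletion L} (hσa : galAdicCompletionMap (L := L) (IsCMField.complexConj L) hw a = a)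
    (hσy : galAdicCompletionMap (L := L) (IsCMField.complexConj L) hw y = -y) :
    Valued.v (a + y) = 1 ↔ Valued.v a = 1 ∧ Valued.v y < 1 := by
  have hy1 := valued_skew_ne_one_ram L w hw he h2w hσy
  rw [valued_fixed_add_skew_eq_max_ram L w hw he h2w hσa hσy]
  constructor
  · intro h
    rcases le_total (Valued.v y) (Valued.v a) with hle | hle
    · rw [max_eq_left hle] at h
      exact ⟨h, lt_of_le_of_ne (h ▸ hle) hy1⟩
    · rw [max_eq_right hle] at h
      exact absurd h hy1
  · rintro ⟨ha, hy⟩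
    rw [ha, max_eq_left hy.le]

/-- **SHELL ONE: `|a + y|_w = q_w ⟺ |y|_w = q_w ∧ |a|_w ≤ 1`** (`q_w = exp 1`; `a` fixed, `y` anti-fixed, tame ramified non-split CM place): by §1 `|a + y|_w = max`, `|a|_w ≠ exp 1`,
and a fixed `a` with `|a|_w ≤ exp 1` has `|a|_w ≤ 1` (even order).  Hence on `Sh 1` the chart point is `y·(1 + a∕y)`, an anti-fixed element of order one times a principal unit — the
input of the ramified odd-shell vanishing `∫_{Sh 1} F₀ = 0`. [cite: SerreLocalFields1979, Ch. III §6, Ch. IV §2 Prop. 5] [cite: Rogawski1990, §1.10 p. 9] [cite: Keys1984, §7 Theorem (2) (d) p. 126] -/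
theorem valued_fixed_add_skew_eq_exp_one_iff_ram (he : v.asIdeal.ramificationIdx' w.1.asIdeal ≠ 1) (h2w : Valued.v (2 : w.1.adicCompletion L) = 1)
    {a y : w.1.adicCompletion L} (hσa : galAdicCompletionMap (L := L) (IsCMField.complexConj L) hw a = a)
    (hσy : galAdicCompletionMap (L := L) (IsCMField.complexConj L) hw y = -y) :
    Valued.v (a + y) = WithZero.exp (1 : ℤ) ↔ Valued.v y = WithZero.exp (1 : ℤ) ∧ Valued.v a ≤ 1 := by
  have ha1 := valued_fixed_ne_exp_one_ram L w hw he hσa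
  -- a fixed `a` with `|a|_w ≤ exp 1` has `|a|_w ≤ 1 = exp 0` (even order)
  have hale : Valued.v a ≤ WithZero.exp (1 : ℤ) → Valued.v a ≤ 1 := by
    intro h
    by_cases ha0 : a = 0
    · rw [ha0, map_zero]; exact zero_le
    obtain ⟨k, hk⟩ := even_log_valued_of_complexConj_eq_self L w hw he ha0 hσa
    have hva0 : Valued.v a ≠ 0 := (Valuation.ne_zero_iff _).2 ha0
    rw [← WithZero.exp_log hva0, hk] at h ⊢
    rw [← WithZero.exp_zero, WithZero.exp_le_exp]
    rw [WithZero.exp_le_exp] at h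
    omega
  rw [valued_fixed_add_skew_eq_max_ram L w hw he h2w hσa hσy]
  constructor
  · intro h
    rcases le_total (Valued.v a) (Valued.v y) with hle | hle
    · rw [max_eq_right hle] at h
      exact ⟨h, hale (h ▸ hle)⟩
    · rw [max_eq_left hle] at h
      exact absurd h ha1
  · rintro ⟨hy, ha⟩
    have hle : Valued.v a ≤ Valued.v y := by
      rw [hy]; exact ha.trans (by rw [← WithZero.exp_zero, WithZero.exp_le_exp]; norm_num)
    rw [max_eq_right hle, hy]

end Summit.HodgeConjecture.HodgeConjecture.R90.S1

end
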